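import Mathlib
import Literature.NumberTheory.LFunctions.Zhang2022.Section4Eq410Edge
import HarnessLib

/-!
# Zhang (2022), §4 (4.10) on the WIDER strip `½ − 3α < σ < 1 + α` (GAP row G-L1t7-1): the
# statements `Lemma44Wide`, `Eq410Wide` and the edge `Eq410Wide ⇐ Lemma41 ∧ Lemma42 ∧ Lemma44Wide`

Topic `Literature/NumberTheory/LFunctions/Zhang2022` (Landau–Siegel audit tree; verdict-neutral).
Y. Zhang, *Discrete mean estimates and the Landau–Siegel zero*, arXiv:2211.02515v1 (2022)
[Zhang2022LandauSiegel] — **an unrefereed manuscript under adjudication; every `def … : Prop`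
below is a CLAIM, stated not asserted.** Campaign D-0069, GAP row G-L1t7-1 [Z22 p.21, (4.10),
tex L1139–L1145 vs. p.22 tex L1227–L1229 and p.23 tex L1269–L1272]: (4.10)
`𝒜(s,ψ) = 1 + ℬ(s,ψ) + O(𝓛⁻¹⁰⁰)` is STATED for `s ∈ Ω₃ = {½ − α < σ < 1 + α, |t − 2πt₀| < 𝓛₁ + 3}`
but USED on the disc `|w| < 2α` around `½ + iγ` (proof of (4.12)) and on Lemma 4.7's circle
`|w| = α(1 + c′α𝓛)`, i.e. down to `σ = ½ − 2α`. The row's wanted repair is (4.10) on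
`Ω₃′ = {½ − 3α < σ < 1 + α, |t − 2πt₀| < 𝓛₁ + 3}`. This file supplies the STATEMENTS and the
algebraic EDGE; the analytic input (Lemma 4.4 on `Ω₃′`, i.e. (4.8) with the contour at
`Re w = −3α…`) remains a CLAIM (`Lemma44Wide`):

* `Omega3Wide D` — `Ω₃′`; `Lemma44Wide`, `Eq410Wide` — Lemma 4.4 / (4.10) with `Ω₃′` for `Ω₃`
  (constants verbatim: `O(𝓛⁻¹⁷⁹)`, `O(𝓛⁻¹⁰⁰)`); `Eq410Wide` is the row's decl verbatim;
* `mem_Omega1_of_mem_Omega3Wide` — `Ω₃′ ⊆ Ω₁` once `𝓛 ≥ 3` (`3α = 3π𝓛⁻⁹ ≤ log𝓛/(100𝓛)`);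
* `eq410Wide_of : Lemma41 → Lemma42 → Lemma44Wide → Eq410Wide` — the deduction of p. 21 verbatim
  on `Ω₃′` (the tree's `Skeleton.eq410_of`, `Section4Eq410Edge`, with the wider inclusion);
* `eq410_of_eq410Wide : Eq410Wide → Eq410`, `mem_Omega3Wide_of_mem_Omega3` — the wide form
  subsumes the banked node.

WHAT THIS IS NOT: a proof of Lemma 4.4 on either region, or any statement about Theorems 1–2 /
Landau–Siegel zeros.

## References

* Y. Zhang, arXiv:2211.02515v1 (2022), §4 Lemma 4.4 (p. 19), (4.10) (p. 21), proof of (4.12)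
  (p. 22), Lemma 4.7 (p. 23). [cite: Zhang2022LandauSiegel, §4 (4.10)]
-/

noncomputable section

open Complex Real

namespace Literature.NumberTheory.LFunctions.Zhang2022.Skeleton

/-- **`Ω₃′ = {½ − 3α < σ < 1 + α, |t − 2πt₀| < 𝓛₁ + 3}`** — Lemma 4.4's region `Ω₃` widened on the
left from `½ − α` to `½ − 3α`, so that it contains the disc `|w| < 2α` and Lemma 4.7's circle around
every critical-line zero `½ + iγ`, `|γ − 2πt₀| < 𝓛₁ + 2` (GAP row G-L1t7-1).
[cite: Zhang2022LandauSiegel, §4 Lemma 4.4, (4.10)] -/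
def Omega3Wide (D : ℕ) : Set ℂ :=
  {s | 1 / 2 - 3 * alpha D < s.re ∧ s.re < 1 + alpha D ∧ |s.im - 2 * π * t0 D| < ell1 D + 3}

/-- **Lemma 4.4 on `Ω₃′`** (the repair wanted by GAP row G-L1t7-1): for `ψ ∈ Ψ₁` and `s ∈ Ω₃′`,
"`L(s,ψ)L(s,ψχ) = F(s,ψ) + Z̃(s,ψ)F(1−s,ψ̄) + O(𝓛⁻¹⁷⁹)`". CLAIM, stated not asserted (the printed
proof, (4.8) with the contour moved to `Re w = −3α…`, is expected to go through verbatim).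
[cite: Zhang2022LandauSiegel, §4 Lemma 4.4] -/
def Lemma44Wide : Prop :=
  ∃ C : ℝ, ForAllLarge fun D _ χ => ∀ x ∈ PsiOne χ, ∀ s ∈ Omega3Wide D,
    ‖LL χ x s - Fpoly χ x s - tildeZW χ x s * FpolyBar χ x (1 - s)‖ ≤ C * (ell D ^ 179)⁻¹

/-- **(4.10) on `Ω₃′`** (GAP row G-L1t7-1, decl wanted, verbatim): for `ψ ∈ Ψ₁` and
`½ − 3α < σ < 1 + α`, `|t − 2πt₀| < 𝓛₁ + 3`: "`𝒜(s,ψ) = 1 + ℬ(s,ψ) + O(𝓛⁻¹⁰⁰)`". CLAIM.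
[cite: Zhang2022LandauSiegel, §4 (4.10)] -/
def Eq410Wide : Prop :=
  ∃ C : ℝ, ForAllLarge fun D _ χ => ∀ x ∈ PsiOne χ, ∀ s : ℂ,
    1 / 2 - 3 * alpha D < s.re → s.re < 1 + alpha D → |s.im - 2 * π * t0 D| < ell1 D + 3 →
      ‖calA χ x s - 1 - calB χ x s‖ ≤ C * (ell D ^ 100)⁻¹

variable {D : ℕ}

/-- `Ω₃ ⊆ Ω₃′` (`α > 0` is not even needed: `½ − 3α ≤ ½ − α` iff `α ≥ 0`, and `α = π/𝓛⁹ ≥ 0`).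
[cite: Zhang2022LandauSiegel, §4 Lemma 4.4] -/
theorem mem_Omega3Wide_of_mem_Omega3 {s : ℂ} (hs : s ∈ Omega3 D) : s ∈ Omega3Wide D := by
  obtain ⟨h1, h2, h3⟩ := hs
  have hα : 0 ≤ alpha D := by
    rw [alpha, bigP, Real.log_exp]
    exact div_nonneg Real.pi_pos.le (pow_nonneg (by rw [ell]; exact Real.log_natCast_nonneg D) 9)
  exact ⟨by linarith, h2, h3⟩

/-- **`Ω₃′ ⊆ Ω₁` for `𝓛 ≥ 3`**: `3α = 3π𝓛⁻⁹ ≤ log𝓛/(100𝓛)` (indeed `300π𝓛 ≤ 𝓛⁹` as `3⁸ = 6561`),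
height range `𝓛₁ + 3 < 𝓛₁ + 5`. [cite: Zhang2022LandauSiegel, §4 Lemma 4.1, Lemma 4.4] -/
theorem mem_Omega1_of_mem_Omega3Wide (hℓ : 3 ≤ ell D) {s : ℂ} (hs : s ∈ Omega3Wide D) :
    s ∈ Omega1 D := by
  obtain ⟨h1, h2, h3⟩ := hs
  have hℓ0 : 0 < ell D := by linarith
  have hlog : 1 ≤ Real.log (ell D) := by
    have h3' : (1 : ℝ) < Real.log 3 := by
      rw [Real.lt_log_iff_exp_lt (by norm_num)]
      exact Real.exp_one_lt_d9.trans (by norm_num)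
    exact le_trans h3'.le (Real.log_le_log (by norm_num) hℓ)
  have hπ : π < 4 := Real.pi_lt_four
  have h3α : 3 * alpha D ≤ Real.log (ell D) / (100 * ell D) := by
    rw [alpha, bigP, Real.log_exp, ← mul_div_assoc,
      div_le_div_iff₀ (pow_pos hℓ0 9) (by positivity)]
    have h8 : (6561 : ℝ) ≤ ell D ^ 8 := by
      calc (6561 : ℝ) = 3 ^ 8 := by norm_num
        _ ≤ ell D ^ 8 := by gcongr
    calc 3 * π * (100 * ell D) ≤ 3 * 4 * (100 * ell D) := by gcongr
      _ ≤ 6561 * ell D := by linarith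
      _ ≤ ell D ^ 8 * ell D := by gcongr
      _ = 1 * ell D ^ 9 := by ring
      _ ≤ Real.log (ell D) * ell D ^ 9 := by gcongr
  have hα := alpha_le_of_three_le_ell hℓ
  rw [Omega1, Lemma43.mem_Omega1_iff]
  exact ⟨by linarith, by linarith, by linarith⟩

/-- The wide (4.10) subsumes the banked node: `Eq410Wide → Eq410` (`Ω₃ ⊆ Ω₃′`).
[cite: Zhang2022LandauSiegel, §4 (4.10)] -/
theorem eq410_of_eq410Wide (h : Eq410Wide) : Eq410 := by
  obtain ⟨C, D₀, hC⟩ := h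
  refine ⟨C, D₀, fun D _ χ hD hq hp x hx s hs => ?_⟩
  obtain ⟨h1, h2, h3⟩ := mem_Omega3Wide_of_mem_Omega3 hs
  exact hC D χ hD hq hp x hx s h1 h2 h3

/-- **(4.10) on `Ω₃′` from Lemmas 4.1, 4.2 and Lemma 4.4 on `Ω₃′`** — the deduction of §4 p. 21
verbatim on the wider strip (GAP row G-L1t7-1's `eq410Wide_of`), constant `2C₄₁⁺C₄₄⁺`: for `𝓛 ≥ 3`
and `C₄₂𝓛⁻²²⁷ ≤ ½`, `s ∈ Ω₃′ ⊆ Ω₁`, so `|FG − 1| ≤ ½` (Lemma 4.2) gives `F ≠ 0`,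
`|F|⁻¹ ≤ 2|G| ≤ 2C₄₁𝓛⁷⁹` (Lemma 4.1), and `𝒜 − 1 − ℬ = (LL − F − Z̃F̄(1−s))/F` with Lemma 4.4 on
`Ω₃′` gives `|𝒜 − 1 − ℬ| ≤ 2C₄₁C₄₄𝓛⁻¹⁰⁰` (adapted from the tree's `Skeleton.eq410_of`).
[cite: Zhang2022LandauSiegel, §4 (4.10)] -/
theorem eq410Wide_of (h41 : Lemma41) (h42 : Lemma42) (h44 : Lemma44Wide) : Eq410Wide := by
  obtain ⟨C₁, h41⟩ := h41
  obtain ⟨C₂, h42⟩ := h42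
  obtain ⟨C₄, h44⟩ := h44
  obtain ⟨D₀, hD₀⟩ := (h41.and h42).and h44
  refine ⟨2 * max C₁ 0 * max C₄ 0, max D₀ ⌈Real.exp (max 3 (2 * C₂))⌉₊,
    fun D _ χ hD hq hp x hx s hs1 hs2 hs3 => ?_⟩
  obtain ⟨⟨e41, e42⟩, e44⟩ := hD₀ D χ (le_trans (le_max_left _ _) hD) hq hp
  have hs : s ∈ Omega3Wide D := ⟨hs1, hs2, hs3⟩
  -- the thresholds: `𝓛 ≥ 3` and `𝓛 ≥ 2C₂`
  have hDe : Real.exp (max 3 (2 * C₂)) ≤ D :=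
    le_trans (Nat.le_ceil _) (by exact_mod_cast le_trans (le_max_right _ _) hD)
  have hℓmax : max 3 (2 * C₂) ≤ ell D :=
    (Real.le_log_iff_exp_le (lt_of_lt_of_le (Real.exp_pos _) hDe)).mpr hDe
  have hℓ3 : 3 ≤ ell D := le_trans (le_max_left _ _) hℓmax
  have hℓC : 2 * C₂ ≤ ell D := le_trans (le_max_right _ _) hℓmax
  have hℓ0 : 0 < ell D := by linarith
  have hℓ1 : 1 ≤ ell D := by linarith
  -- `s ∈ Ω₁`, so Lemmas 4.1 and 4.2 apply at `s`
  have hΩ1 : s ∈ Omega1 D := mem_Omega1_of_mem_Omega3Wide hℓ3 hs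
  have b41 := e41 x hx s hΩ1
  have b42 := e42 x hx s hΩ1
  have b44 := e44 x hx s hs
  -- `C₂𝓛⁻²²⁷ ≤ 1/2`
  have hhalf : C₂ * (ell D ^ 227)⁻¹ ≤ 1 / 2 := by
    have h227 : ell D ≤ ell D ^ 227 := by
      calc ell D = ell D ^ 1 := (pow_one _).symm
        _ ≤ ell D ^ 227 := pow_le_pow_right₀ hℓ1 (by norm_num)
    have hpos : 0 < ell D ^ 227 := pow_pos hℓ0 _
    rw [← div_eq_mul_inv, div_le_iff₀ hpos]
    linarith
  obtain ⟨hF0, hFinv⟩ := inv_norm_le_two_mul_of_norm_mul_sub_one_le (b42.trans hhalf)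
  have hG : ‖Gpoly χ x s‖ ≤ max C₁ 0 * ell D ^ 79 :=
    calc ‖Gpoly χ x s‖ ≤ ‖Fpoly χ x s‖ + ‖Gpoly χ x s‖ := le_add_of_nonneg_left (norm_nonneg _)
      _ ≤ C₁ * ell D ^ 79 := b41
      _ ≤ max C₁ 0 * ell D ^ 79 := by gcongr; exact le_max_left _ _
  have hFinv' : ‖Fpoly χ x s‖⁻¹ ≤ 2 * (max C₁ 0 * ell D ^ 79) := hFinv.trans (by linarith)
  have halg : calA χ x s - 1 - calB χ x s =
      (LL χ x s - Fpoly χ x s - tildeZW χ x s * FpolyBar χ x (1 - s)) / Fpoly χ x s := by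
    rw [calA, calB]
    field_simp
  have b44' : ‖LL χ x s - Fpoly χ x s - tildeZW χ x s * FpolyBar χ x (1 - s)‖
      ≤ max C₄ 0 * (ell D ^ 179)⁻¹ :=
    b44.trans (by gcongr; exact le_max_left _ _)
  have h79 : ell D ^ 79 * (ell D ^ 179)⁻¹ = (ell D ^ 100)⁻¹ := by
    field_simp
  calc ‖calA χ x s - 1 - calB χ x s‖
      = ‖LL χ x s - Fpoly χ x s - tildeZW χ x s * FpolyBar χ x (1 - s)‖ * ‖Fpoly χ x s‖⁻¹ := by
        rw [halg, norm_div, div_eq_mul_inv]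
    _ ≤ (max C₄ 0 * (ell D ^ 179)⁻¹) * (2 * (max C₁ 0 * ell D ^ 79)) :=
        mul_le_mul b44' hFinv' (inv_nonneg.mpr (norm_nonneg _)) (by positivity)
    _ = 2 * max C₁ 0 * max C₄ 0 * (ell D ^ 79 * (ell D ^ 179)⁻¹) := by ring
    _ = 2 * max C₁ 0 * max C₄ 0 * (ell D ^ 100)⁻¹ := by rw [h79]

end Literature.NumberTheory.LFunctions.Zhang2022.Skeleton

end
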